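import Summits.AnomalousDissipation.AnomalousDissipation.Theorems.SolenoidalFractalHomogenisationLagrangianStepVmodSSRegimesA
import Summits.AnomalousDissipation.AnomalousDissipation.Theorems.SolenoidalFractalHomogenisationLagrangianStepVmodSSScalars
import Summits.AnomalousDissipation.AnomalousDissipation.Theorems.SolenoidalFractalHomogenisationLagrangianStepVmodHigh
import Summits.AnomalousDissipation.AnomalousDissipation.Theorems.SolenoidalFractalHomogenisationLagrangianStepVmodCoarseDecay
import HarnessLib

/-!
# K1L_D (stmt-AnomalousDissipation-27980): (V_mod) flat stage, block (ss) — REGIME LEMMAS IN THE FINAL CURRENCY, part B: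
# the carrier-free decay at a mode, the `ν`-floor regime, and the two HIGH-LABEL long-window regimes
(helper; `--supports 27980 --as helper`; prover ad-sawtooth-k1loc-p1 g15; rows «high label, τ > P» of the certifier's table
`Cruxes/LagrangianRenormalisationStep/Lines/onelevel-ss-regimes.md`; target currency = `VmodFlat.SSMode_textEH`.)

Notation as in part A (`R = 8π²·loT·|ℓ|²`, `τ = t − s`, `P = M·W.period/ν`, allowance `A(τ) = C₁(C₁(ν^e + (⌈K/ν⌉/n)^e) + (min 1 (P/τ))^e)`).
* `norm_fc_free_le_exp` — `‖𝓕(T v)(ℓ)‖ ≤ e^{−Rτ/2}‖𝓕v(ℓ)‖` for the carrier-free propagator of the clause;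
* `defect_le_alw_of_floor` — `Rτ ≥ 1`, `ν ≥ ν_f`: trivial bound against `C₁²ν^e` (`C₁ ≥ 1`, `C₁ ≥ 6/ν_f`, `e ≤ 1`);
* **`defect_le_alw_of_high_gen`** — `Rτ ≤ 1`, `τ > P`, `RP ≥ θ′`: generator regime charged to `C₁(P/τ)^e` (`C₁θ′ ≥ 2cG`, `e ≤ 1`);
* **`defect_le_alw_of_high_long`** — `Rτ ≥ 1`, `τ > P`, `RP ≥ θ′`, `nν ≤ Kb‖ℓ‖`: `ν ≥ νh` by the floor, `ν < νh` by `HighLabelDecayW` for `U`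
  and the carrier-free decay for `T` (`x·e^{−x} ≤ 1`), with `C₁ ≥ 4√(2CK)/(cK·M·W.period) + 8/θ′`.
`sorry`-free; NOT a proof of (ss), of the stub, of K1L_D or of AD; rung F-D1.A0.
-/

set_option linter.dupNamespace false

noncomputable section

namespace Summit.AnomalousDissipation.AnomalousDissipation.Theorems.SolenoidalFractalHomogenisation.LagrangianStep.VmodGen

open Set MeasureTheory Complex UnitAddTorus
open scoped InnerProductSpace ENNReal
open Literature.Analysis Literature.Analysis.FunctionSpaces Literature.Analysis.FunctionSpaces.Torus
open Literature.Analysis.FluidPDE Literature.Analysis.FluidPDE.Torus Literature.Analysis.FluidPDE.LatticeShear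
open Summit.AnomalousDissipation.AnomalousDissipation.Theorems.SolenoidalFractalHomogenisation.LagrangianStep.Sideband (slotAmp)
open Summit.AnomalousDissipation.AnomalousDissipation.Theorems.SolenoidalFractalHomogenisation.LagrangianStep.VmodFlat
  (fc fc_sub loT dW norm_sq_fcoeff_carrierFree_decay)

/-! ## The carrier-free decay at a mode, and the three regimes (scalar tools in `…VmodSSScalars`) -/

section Clause

variable {k : ℕ} {W : LatticeWord k} {M : ℝ} {hM : 0 < M} {c : ℝ}
  {Φ : ℝ → Visc4 (Fin 3) → Visc4 (Fin 3)} {lo hi Λ β σ C ν₀ K : ℝ}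
  {ν : ℝ} {n : ℕ} {𝔸 : Visc4 (Fin 3)} {Tw : ℝ} {U T : ℝ → ℝ → (V2 →L[ℝ] V2)}

/-- **Carrier-free decay at a mode** for the clause's comparison propagator `T` (tensor `(1/n²)(𝔸 + (c/ν)Φ′) ≥ loT` as forms):
`‖𝓕(T(s,t)y)(ℓ)‖ ≤ exp(−4π²·loT·|ℓ|²·(t − s))·‖𝓕y(ℓ)‖`. -/
theorem norm_fc_free_le_exp (hlo : 0 < lo) (hΛ : 1 ≤ Λ) (hc : 0 ≤ c) (hν : ν ∈ Set.Ioo 0 ν₀) (hn : 1 ≤ n)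
    (hwin : ∃ lam ∈ Set.Icc (1:ℝ) Λ, NearIso 𝔸 (ν * (lo / lam)) (ν * (hi * lam)))
    (hΦw : ∃ lam ∈ Set.Icc (1:ℝ) Λ, NearIso (Φ ν ((1 / ν) • 𝔸)) (lo / lam) (hi * lam))
    (hT : IsPropagator Tw (fun (_ : ℝ) (_ : UnitAddTorus (Fin 3)) => (0 : EuclideanSpace ℝ (Fin 3)))
      ((1 / (n:ℝ) ^ 2) • (𝔸 + (c / ν) • Φ ν ((1 / ν) • 𝔸))) T)
    {s t : ℝ} (hs : 0 ≤ s) (hst : s ≤ t) (htT : t ≤ Tw) (hsT : s < Tw) (ℓ : Fin 3 → ℤ) (y : V2) (hy : y ∈ divFreeL2 (Fin 3)) :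
    ‖fc (T s t y) ℓ‖ ≤ Real.exp (-(4 * Real.pi ^ 2 * loT lo Λ c ν n * Torus.freqNormSq ℓ * (t - s))) * ‖fc y ℓ‖ := by
  have hn0 : (0:ℝ) < n := by exact_mod_cast (show 0 < n from hn)
  have hn2 : (0:ℝ) < 1 / (n:ℝ) ^ 2 := by positivity
  have hΛ0 : 0 < Λ := lt_of_lt_of_le one_pos hΛ
  have hcν : 0 ≤ c / ν := div_nonneg hc hν.1.le
  obtain ⟨lam, hlam, hA⟩ := hwin
  obtain ⟨lam', hlam', hΦn⟩ := hΦw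
  have hlam0 : 0 < lam := lt_of_lt_of_le one_pos hlam.1
  have hlam'0 : 0 < lam' := lt_of_lt_of_le one_pos hlam'.1
  have hcoarse0 : NearIso ((1 / (n:ℝ) ^ 2) • (𝔸 + (c / ν) • Φ ν ((1 / ν) • 𝔸)))
      ((1 / (n:ℝ) ^ 2) * (ν * (lo / lam) + (c / ν) * (lo / lam'))) ((1 / (n:ℝ) ^ 2) * (ν * (hi * lam) + (c / ν) * (hi * lam'))) :=
    (hA.add (hΦn.smul hcν)).smul hn2.le
  have hloT_le : loT lo Λ c ν n ≤ (1 / (n:ℝ) ^ 2) * (ν * (lo / lam) + (c / ν) * (lo / lam')) := by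
    unfold loT
    have h1 : lo / Λ ≤ lo / lam := div_le_div_of_nonneg_left hlo.le hlam0 hlam.2
    have h2 : lo / Λ ≤ lo / lam' := div_le_div_of_nonneg_left hlo.le hlam'0 hlam'.2
    have h3 : (ν + c / ν) * (lo / Λ) ≤ ν * (lo / lam) + (c / ν) * (lo / lam') := by
      have := mul_le_mul_of_nonneg_left h1 hν.1.le
      have := mul_le_mul_of_nonneg_left h2 hcν
      nlinarith
    exact mul_le_mul_of_nonneg_left h3 hn2.le
  have hloT : 0 < loT lo Λ c ν n := by
    unfold loT
    have hνc : 0 < ν + c / ν := by have := hν.1; positivity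
    exact mul_pos hn2 (mul_pos hνc (div_pos hlo hΛ0))
  have hcoarse : NearIso ((1 / (n:ℝ) ^ 2) • (𝔸 + (c / ν) • Φ ν ((1 / ν) • 𝔸)))
      (loT lo Λ c ν n) ((1 / (n:ℝ) ^ 2) * (ν * (hi * lam) + (c / ν) * (hi * lam'))) := hcoarse0.mono hloT_le le_rfl
  have h1 := norm_sq_fcoeff_carrierFree_decay hcoarse hloT hT hs hst htT hsT y ((mem_divFreeL2_iff y).1 hy) ℓ
  have h2 : Real.exp (-(8 * Real.pi ^ 2 * loT lo Λ c ν n * Torus.freqNormSq ℓ * (t - s))) * ‖fc y ℓ‖ ^ 2 =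
      (Real.exp (-(4 * Real.pi ^ 2 * loT lo Λ c ν n * Torus.freqNormSq ℓ * (t - s))) * ‖fc y ℓ‖) ^ 2 := by
    rw [mul_pow, ← Real.exp_nat_mul]; congr 2; push_cast; ring
  rw [h2] at h1
  exact (pow_le_pow_iff_left₀ (norm_nonneg _) (by positivity) two_ne_zero).1 h1

/-- **THE `ν`-FLOOR REGIME** (`Rτ ≥ 1`, `ν_f ≤ ν ≤ 1`): the target inequality with `C₁ ≥ 1`, `C₁ ≥ 6/ν_f`, `e ≤ 1`
(trivial bound; `dW ≥ ½`; `C₁²ν^e ≥ C₁·(6/ν_f)·ν ≥ 6`). -/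
theorem defect_le_alw_of_floor (hν : ν ∈ Set.Ioo 0 ν₀) (hν1 : ν ≤ 1) (hn : 1 ≤ n)
    (hU : IsPropagator Tw (cellField W M hM ν hν.1 n) ((1 / (n:ℝ) ^ 2) • 𝔸) U)
    (hT : IsPropagator Tw (fun (_ : ℝ) (_ : UnitAddTorus (Fin 3)) => (0 : EuclideanSpace ℝ (Fin 3)))
      ((1 / (n:ℝ) ^ 2) • (𝔸 + (c / ν) • Φ ν ((1 / ν) • 𝔸))) T)
    {s t : ℝ} (hst : s < t) {ℓ : Fin 3 → ℤ} (hℓ0 : ℓ ≠ 0) (v : V2) (hvs : ∀ k', k' ≠ ℓ → k' ≠ -ℓ → fc v k' = 0)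
    {C₁ e νf : ℝ} (hC₁1 : 1 ≤ C₁) (hνf0 : 0 < νf) (hC₁f : 6 / νf ≤ C₁) (hνf : νf ≤ ν) (he1 : e ≤ 1)
    (hRτ : 1 ≤ 8 * Real.pi ^ 2 * loT lo Λ c ν n * Torus.freqNormSq ℓ * (t - s)) :
    ‖fc (U s t v - T s t v) ℓ‖
      ≤ (C₁ * (C₁ * (ν ^ e + ((⌈K / ν⌉₊ : ℝ) / n) ^ e) + (min 1 ((M * W.period / ν) / (t - s))) ^ e))
        * dW lo Λ c ν n (t - s) ℓ * ‖fc v ℓ‖ := by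
  have hn0 : (0:ℝ) < n := by exact_mod_cast (show 0 < n from hn)
  have hC₁0 : 0 ≤ C₁ := by linarith
  have htriv := defect_le_three_mul hℓ0 (U s t) (T s t) (hU.norm_le s t) (hT.norm_le s t) v hvs
  have hRτ0 : 0 ≤ 8 * Real.pi ^ 2 * loT lo Λ c ν n * Torus.freqNormSq ℓ * (t - s) := le_trans zero_le_one hRτ
  have hdW : (1 / 2 : ℝ) ≤ dW lo Λ c ν n (t - s) ℓ := by
    have h := one_sub_exp_neg_ge hRτ0
    rw [min_eq_left hRτ] at h
    unfold dW; linarith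
  -- `C₁²·ν^e ≥ 6`
  have hνe : ν ≤ ν ^ e := by have h := Real.rpow_le_rpow_of_exponent_ge hν.1 hν1 he1; rwa [Real.rpow_one] at h
  have h6 : 6 ≤ C₁ * (C₁ * ν ^ e) := by
    have h1 : 6 ≤ C₁ * ν := by
      have := (div_le_iff₀ hνf0).1 hC₁f
      nlinarith
    have h2 : C₁ * ν ≤ C₁ * ν ^ e := mul_le_mul_of_nonneg_left hνe hC₁0
    nlinarith
  have halw : 6 ≤ C₁ * (C₁ * (ν ^ e + ((⌈K / ν⌉₊ : ℝ) / n) ^ e) + (min 1 ((M * W.period / ν) / (t - s))) ^ e) := by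
    have hb : 0 ≤ ((⌈K / ν⌉₊ : ℝ) / n) ^ e := Real.rpow_nonneg (by positivity) e
    have hm : 0 ≤ (min 1 ((M * W.period / ν) / (t - s))) ^ e := Real.rpow_nonneg (le_min zero_le_one (by
      have : 0 < t - s := by linarith
      exact div_nonneg (div_nonneg (mul_nonneg hM.le (PermissibleCarrier.period_pos W).le) hν.1.le) this.le)) e
    nlinarith [mul_nonneg hC₁0 (mul_nonneg hC₁0 hb), mul_nonneg hC₁0 hm]
  have hv0 := norm_nonneg (fc v ℓ)
  have hdW0 : 0 ≤ dW lo Λ c ν n (t - s) ℓ := le_trans (by norm_num) hdW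
  calc ‖fc (U s t v - T s t v) ℓ‖ ≤ 3 * ‖fc v ℓ‖ := htriv
    _ ≤ 6 * (1 / 2) * ‖fc v ℓ‖ := by nlinarith
    _ ≤ 6 * dW lo Λ c ν n (t - s) ℓ * ‖fc v ℓ‖ := mul_le_mul_of_nonneg_right (mul_le_mul_of_nonneg_left hdW (by norm_num)) hv0
    _ ≤ _ := mul_le_mul_of_nonneg_right (mul_le_mul_of_nonneg_right halw hdW0) hv0

set_option maxHeartbeats 1600000 in
/-- **HIGH LABELS, GENERATOR REGIME** (`Rτ ≤ 1`, `τ > P`, `RP ≥ θ′`): the target inequality with `C₁·θ′ ≥ 2·KG·Λ/(8π²c·lo)`, `0 < e ≤ 1`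
(the generator bound `≤ 2cG·dW`, charged to `C₁(P/τ)^e ≥ C₁·(P/τ) ≥ C₁·RP ≥ C₁θ′`). -/
theorem defect_le_alw_of_high_gen (hlo : 0 < lo) (hhi : 0 ≤ hi) (hΛ : 1 ≤ Λ) (hβ : 0 ≤ β) (hc : 0 < c)
    (hν : ν ∈ Set.Ioo 0 ν₀) (hn : 1 ≤ n)
    (hwin : ∃ lam ∈ Set.Icc (1:ℝ) Λ, NearIso 𝔸 (ν * (lo / lam)) (ν * (hi * lam)))
    (hΦo : OddSmall (Φ ν ((1 / ν) • 𝔸)) β) (hΦw : ∃ lam ∈ Set.Icc (1:ℝ) Λ, NearIso (Φ ν ((1 / ν) • 𝔸)) (lo / lam) (hi * lam))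
    (hU : IsPropagator Tw (cellField W M hM ν hν.1 n) ((1 / (n:ℝ) ^ 2) • 𝔸) U)
    (hT : IsPropagator Tw (fun (_ : ℝ) (_ : UnitAddTorus (Fin 3)) => (0 : EuclideanSpace ℝ (Fin 3)))
      ((1 / (n:ℝ) ^ 2) • (𝔸 + (c / ν) • Φ ν ((1 / ν) • 𝔸))) T)
    {s t : ℝ} (hs : 0 ≤ s) (hst : s < t) (htT : t ≤ Tw) (hphase : ∀ τ, cellField W M hM ν hν.1 n (s + τ) = cellField W M hM ν hν.1 n τ)
    {ℓ : Fin 3 → ℤ} (hℓ0 : ℓ ≠ 0) (hℓn : 2 * Real.sqrt (freqNormSq ℓ) < n)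
    (v : V2) (hv : v ∈ divFreeL2 (Fin 3)) (hvs : ∀ k', k' ≠ ℓ → k' ≠ -ℓ → fc v k' = 0)
    {C₁ e θ' : ℝ} (hC₁0 : 0 ≤ C₁)
    (hC₁ : 2 * ((4 * Real.pi ^ 2 * c * (hi * Λ + β / 2) + 32 * Real.sqrt 2 * Λ * (∑ j, ‖slotAmp W j‖) ^ 2 / lo) * Λ /
      (8 * Real.pi ^ 2 * c * lo)) ≤ C₁ * θ')
    (hθ' : θ' ≤ 8 * Real.pi ^ 2 * loT lo Λ c ν n * Torus.freqNormSq ℓ * (M * W.period / ν)) (he1 : e ≤ 1)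
    (hRτ : 8 * Real.pi ^ 2 * loT lo Λ c ν n * Torus.freqNormSq ℓ * (t - s) ≤ 1) (hτP : M * W.period / ν < t - s) :
    ‖fc (U s t v - T s t v) ℓ‖
      ≤ (C₁ * (C₁ * (ν ^ e + ((⌈K / ν⌉₊ : ℝ) / n) ^ e) + (min 1 ((M * W.period / ν) / (t - s))) ^ e))
        * dW lo Λ c ν n (t - s) ℓ * ‖fc v ℓ‖ := by
  have hτ0 : 0 < t - s := by linarith
  have hsT : s < Tw := lt_of_lt_of_le hst htT
  have hn0 : (0:ℝ) < n := by exact_mod_cast (show 0 < n from hn)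
  have hΛ0 : 0 < Λ := lt_of_lt_of_le one_pos hΛ
  have hWp := PermissibleCarrier.period_pos W
  have hP0 : 0 < M * W.period / ν := div_pos (mul_pos hM hWp) hν.1
  -- the generator bound
  have hgen := norm_fc_sub_le_generator W M hM hc.le hlo hhi hΛ hβ hν.1 hn hwin hΦo hΦw hU hT hs hst.le htT hsT hphase hℓ0 hℓn v hv hvs
  set KG : ℝ := 4 * Real.pi ^ 2 * c * (hi * Λ + β / 2) + 32 * Real.sqrt 2 * Λ * (∑ j, ‖slotAmp W j‖) ^ 2 / lo with hKG
  have hKG0 : 0 ≤ KG := by rw [hKG]; positivity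
  set R : ℝ := 8 * Real.pi ^ 2 * loT lo Λ c ν n * Torus.freqNormSq ℓ with hR
  have hq : freqNormSq ℓ / ((n:ℝ) ^ 2 * ν) ≤ Λ / (8 * Real.pi ^ 2 * c * lo) * R := by
    rw [hR]; unfold loT
    have hq0 := freqNormSq_nonneg ℓ
    have h1 : 8 * Real.pi ^ 2 * ((1 / (n:ℝ) ^ 2) * ((c / ν) * (lo / Λ))) * freqNormSq ℓ
        ≤ 8 * Real.pi ^ 2 * ((1 / (n:ℝ) ^ 2) * ((ν + c / ν) * (lo / Λ))) * freqNormSq ℓ := by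
      have : c / ν ≤ ν + c / ν := by linarith [hν.1]
      have : (c / ν) * (lo / Λ) ≤ (ν + c / ν) * (lo / Λ) := mul_le_mul_of_nonneg_right this (div_pos hlo hΛ0).le
      have h3 : (1 / (n:ℝ) ^ 2) * ((c / ν) * (lo / Λ)) ≤ (1 / (n:ℝ) ^ 2) * ((ν + c / ν) * (lo / Λ)) :=
        mul_le_mul_of_nonneg_left this (by positivity)
      exact mul_le_mul_of_nonneg_right (mul_le_mul_of_nonneg_left h3 (by positivity)) hq0
    have e1 : freqNormSq ℓ / ((n:ℝ) ^ 2 * ν) =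
        Λ / (8 * Real.pi ^ 2 * c * lo) * (8 * Real.pi ^ 2 * ((1 / (n:ℝ) ^ 2) * ((c / ν) * (lo / Λ))) * freqNormSq ℓ) := by
      field_simp
    rw [e1]
    exact mul_le_mul_of_nonneg_left h1 (by positivity)
  have hdefect : ‖fc (U s t v - T s t v) ℓ‖ ≤ (KG * Λ / (8 * Real.pi ^ 2 * c * lo)) * (R * (t - s)) * ‖fc v ℓ‖ := by
    refine hgen.trans ?_
    have := mul_le_mul_of_nonneg_left hq hKG0
    have h2 : KG * (freqNormSq ℓ / ((n:ℝ) ^ 2 * ν)) * (t - s) ≤ (KG * Λ / (8 * Real.pi ^ 2 * c * lo)) * (R * (t - s)) := by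
      have := mul_le_mul_of_nonneg_right this hτ0.le
      calc KG * (freqNormSq ℓ / ((n:ℝ) ^ 2 * ν)) * (t - s) ≤ KG * (Λ / (8 * Real.pi ^ 2 * c * lo) * R) * (t - s) := this
        _ = (KG * Λ / (8 * Real.pi ^ 2 * c * lo)) * (R * (t - s)) := by ring
    exact mul_le_mul_of_nonneg_right h2 (norm_nonneg _)
  have hR0 : 0 ≤ R := by
    rw [hR]; unfold loT
    have := freqNormSq_nonneg ℓ; have := hν.1; have : 0 ≤ ν + c / ν := by positivity
    positivity
  have hRτ0 : 0 ≤ R * (t - s) := mul_nonneg hR0 hτ0.le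
  have hdW : (1 / 2) * (R * (t - s)) ≤ dW lo Λ c ν n (t - s) ℓ := by
    have h := one_sub_exp_neg_ge hRτ0
    rw [min_eq_right (by rw [hR]; exact hRτ)] at h
    unfold dW
    rw [show 8 * Real.pi ^ 2 * loT lo Λ c ν n * Torus.freqNormSq ℓ * (t - s) = R * (t - s) by rw [hR]]
    exact h
  have hdW0 : 0 ≤ dW lo Λ c ν n (t - s) ℓ := le_trans (by positivity) hdW
  -- the allowance dominates `C₁θ′`: `(min 1 (P/τ))^e = (P/τ)^e ≥ P/τ ≥ RP ≥ θ′`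
  have hPτ1 : M * W.period / ν / (t - s) ≤ 1 := (div_le_one hτ0).2 hτP.le
  have hPτ0 : 0 < M * W.period / ν / (t - s) := div_pos hP0 hτ0
  have hmin : min 1 (M * W.period / ν / (t - s)) = M * W.period / ν / (t - s) := min_eq_right hPτ1
  have hRP : θ' ≤ M * W.period / ν / (t - s) := by
    refine hθ'.trans ?_
    rw [show 8 * Real.pi ^ 2 * loT lo Λ c ν n * Torus.freqNormSq ℓ * (M * W.period / ν) = R * (M * W.period / ν) by rw [hR]]
    rw [le_div_iff₀ hτ0]
    have := mul_le_mul_of_nonneg_left (show R * (t - s) ≤ 1 by rw [hR]; exact hRτ) hP0.le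
    nlinarith
  have halw : C₁ * θ' ≤ C₁ * (C₁ * (ν ^ e + ((⌈K / ν⌉₊ : ℝ) / n) ^ e) + (min 1 ((M * W.period / ν) / (t - s))) ^ e) := by
    rw [hmin]
    have h1 : θ' ≤ (M * W.period / ν / (t - s)) ^ e :=
      hRP.trans (by have h := Real.rpow_le_rpow_of_exponent_ge hPτ0 hPτ1 he1; rwa [Real.rpow_one] at h)
    have hb : 0 ≤ C₁ * (ν ^ e + ((⌈K / ν⌉₊ : ℝ) / n) ^ e) :=
      mul_nonneg hC₁0 (add_nonneg (Real.rpow_nonneg hν.1.le e) (Real.rpow_nonneg (by positivity) e))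
    exact mul_le_mul_of_nonneg_left (by linarith) hC₁0
  have hcG0 : 0 ≤ KG * Λ / (8 * Real.pi ^ 2 * c * lo) := by positivity
  calc ‖fc (U s t v - T s t v) ℓ‖ ≤ (KG * Λ / (8 * Real.pi ^ 2 * c * lo)) * (R * (t - s)) * ‖fc v ℓ‖ := hdefect
    _ ≤ (KG * Λ / (8 * Real.pi ^ 2 * c * lo)) * (2 * dW lo Λ c ν n (t - s) ℓ) * ‖fc v ℓ‖ := by
        refine mul_le_mul_of_nonneg_right (mul_le_mul_of_nonneg_left (by linarith) hcG0) (norm_nonneg _)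
    _ = (2 * (KG * Λ / (8 * Real.pi ^ 2 * c * lo))) * dW lo Λ c ν n (t - s) ℓ * ‖fc v ℓ‖ := by ring
    _ ≤ (C₁ * θ') * dW lo Λ c ν n (t - s) ℓ * ‖fc v ℓ‖ := by
        exact mul_le_mul_of_nonneg_right (mul_le_mul_of_nonneg_right (by rw [hKG] at hC₁ ⊢; exact hC₁) hdW0) (norm_nonneg _)
    _ ≤ _ := mul_le_mul_of_nonneg_right (mul_le_mul_of_nonneg_right halw hdW0) (norm_nonneg _)

set_option maxHeartbeats 1600000 in
/-- **HIGH LABELS, LONG WINDOWS** (`Rτ ≥ 1`, `τ > P`, `RP ≥ θ′`, `n·ν ≤ Kb·‖ℓ‖`, `2‖ℓ‖ ≤ n`): the target inequality with `C₁ ≥ 1`,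
`C₁ ≥ 6/νh`, `C₁ ≥ 4√(2CK)/(cK·M·W.period) + 8/θ′`, `e ≤ 1`.  For `ν ≥ νh` this is the floor regime; for `ν < νh` the
high-label decay `‖U v‖ ≤ √CK·e^{−cKντ}‖v‖` and the carrier-free decay `‖𝓕(Tv)(ℓ)‖ ≤ e^{−Rτ/2}‖𝓕v(ℓ)‖`, with `e^{−x} ≤ 1/x`,
give `defect ≤ (√(2CK)/(cK·M·Wp) + 2/θ′)·(P/τ)·‖𝓕v(ℓ)‖`. -/
theorem defect_le_alw_of_high_long {νh Kb CK cK : ℝ} (hH : HighLabelDecayW W M hM lo hi Λ β νh Kb CK cK)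
    (hCK : 1 ≤ CK) (hcK : 0 < cK) (hνh : 0 < νh)
    (hlo : 0 < lo) (hhi : 0 ≤ hi) (hΛ : 1 ≤ Λ) (hc : 0 ≤ c) (hν : ν ∈ Set.Ioo 0 ν₀) (hν1 : ν ≤ 1) (hn : 1 ≤ n)
    (hodd : OddSmall 𝔸 (ν * β)) (hwin : ∃ lam ∈ Set.Icc (1:ℝ) Λ, NearIso 𝔸 (ν * (lo / lam)) (ν * (hi * lam)))
    (hΦw : ∃ lam ∈ Set.Icc (1:ℝ) Λ, NearIso (Φ ν ((1 / ν) • 𝔸)) (lo / lam) (hi * lam))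
    (hU : IsPropagator Tw (cellField W M hM ν hν.1 n) ((1 / (n:ℝ) ^ 2) • 𝔸) U)
    (hT : IsPropagator Tw (fun (_ : ℝ) (_ : UnitAddTorus (Fin 3)) => (0 : EuclideanSpace ℝ (Fin 3)))
      ((1 / (n:ℝ) ^ 2) • (𝔸 + (c / ν) • Φ ν ((1 / ν) • 𝔸))) T)
    {s t : ℝ} (hs : 0 ≤ s) (hst : s < t) (htT : t ≤ Tw) (hphase : ∀ τ, cellField W M hM ν hν.1 n (s + τ) = cellField W M hM ν hν.1 n τ)
    {ℓ : Fin 3 → ℤ} (hℓ0 : ℓ ≠ 0) (hℓn : 2 * ‖Torus.latticeVec ℓ‖ ≤ n) (hKb : (n : ℝ) * ν ≤ Kb * ‖Torus.latticeVec ℓ‖)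
    (v : V2) (hv : v ∈ divFreeL2 (Fin 3)) (hvs : ∀ k', k' ≠ ℓ → k' ≠ -ℓ → fc v k' = 0)
    {C₁ e θ' : ℝ} (hC₁1 : 1 ≤ C₁) (hC₁h : 6 / νh ≤ C₁) (hθ'0 : 0 < θ')
    (hθ' : θ' ≤ 8 * Real.pi ^ 2 * loT lo Λ c ν n * Torus.freqNormSq ℓ * (M * W.period / ν))
    (hC₁d : 4 * Real.sqrt (2 * CK) / (cK * (M * W.period)) + 8 / θ' ≤ C₁) (he1 : e ≤ 1)
    (hRτ : 1 ≤ 8 * Real.pi ^ 2 * loT lo Λ c ν n * Torus.freqNormSq ℓ * (t - s)) (hτP : M * W.period / ν < t - s) :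
    ‖fc (U s t v - T s t v) ℓ‖
      ≤ (C₁ * (C₁ * (ν ^ e + ((⌈K / ν⌉₊ : ℝ) / n) ^ e) + (min 1 ((M * W.period / ν) / (t - s))) ^ e))
        * dW lo Λ c ν n (t - s) ℓ * ‖fc v ℓ‖ := by
  by_cases hνν : νh ≤ ν
  · exact defect_le_alw_of_floor hν hν1 hn hU hT hst hℓ0 v hvs hC₁1 hνh hC₁h hνν he1 hRτ
  push Not at hνν
  have hν' : ν ∈ Set.Ioo 0 νh := ⟨hν.1, hνν⟩
  have hτ0 : 0 < t - s := by linarith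
  have hsT : s < Tw := lt_of_lt_of_le hst htT
  have hn0 : (0:ℝ) < n := by exact_mod_cast (show 0 < n from hn)
  have hC₁0 : 0 ≤ C₁ := by linarith
  have hWp := PermissibleCarrier.period_pos W
  have hMW : 0 < M * W.period := mul_pos hM hWp
  have hP0 : 0 < M * W.period / ν := div_pos hMW hν.1
  have hL0 : 0 < ‖Torus.latticeVec ℓ‖ := by
    refine norm_pos_iff.2 fun h => hℓ0 ?_
    funext i
    have hi := congrArg (fun w : EuclideanSpace ℝ (Fin 3) => w i) h
    simpa [Torus.latticeVec_apply] using hi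
  set R : ℝ := 8 * Real.pi ^ 2 * loT lo Λ c ν n * Torus.freqNormSq ℓ with hR
  have hRτ1 : 1 ≤ R * (t - s) := by rw [hR]; exact hRτ
  have hRpos : 0 < R := by
    by_contra h; push Not at h
    have := mul_nonpos_of_nonpos_of_nonneg h hτ0.le
    linarith
  -- ### the two pieces
  have hUv : ‖U s t v‖ ≤ Real.sqrt CK * Real.exp (-(cK * ν * (t - s))) * ‖v‖ :=
    norm_apply_le_of_highLabelDecay W M hM hH hlo hhi hΛ (by linarith) hν' hn hodd hwin hU hs hst.le htT hsT hphase
      hL0 hKb hℓ0 le_rfl hℓn v hv hvs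
  have hvn : ‖v‖ = Real.sqrt 2 * ‖fc v ℓ‖ := norm_eq_sqrt_two_mul_of_pair hℓ0 v hvs
  have hTv : ‖fc (T s t v) ℓ‖ ≤ Real.exp (-(R * (t - s) / 2)) * ‖fc v ℓ‖ := by
    have h := norm_fc_free_le_exp hlo hΛ hc hν hn hwin hΦw hT hs hst.le htT hsT ℓ v hv
    rwa [show 4 * Real.pi ^ 2 * loT lo Λ c ν n * Torus.freqNormSq ℓ * (t - s) = R * (t - s) / 2 by rw [hR]; ring] at h
  -- `e^{−x} ≤ 1/x` (`x ≤ 1 + x ≤ e^x`)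
  have hexp : ∀ x : ℝ, 0 < x → Real.exp (-x) ≤ 1 / x := fun x hx => by
    rw [Real.exp_neg, ← one_div]
    exact one_div_le_one_div_of_le hx (by linarith [Real.add_one_le_exp x])
  have hx1 : Real.exp (-(cK * ν * (t - s))) ≤ 1 / (cK * ν * (t - s)) := hexp _ (by have := hν.1; positivity)
  have hx2 : Real.exp (-(R * (t - s) / 2)) ≤ 1 / (R * (t - s) / 2) := hexp _ (by positivity)
  have hv0 := norm_nonneg (fc v ℓ)
  -- ### defect ≤ (√(2CK)/(cK ν τ) + 2/(Rτ))‖𝓕v(ℓ)‖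
  have hdef : ‖fc (U s t v - T s t v) ℓ‖
      ≤ (Real.sqrt (2 * CK) / (cK * ν * (t - s)) + 2 / (R * (t - s))) * ‖fc v ℓ‖ := by
    rw [fc_sub]
    have h1 : ‖fc (U s t v) ℓ‖ ≤ Real.sqrt (2 * CK) / (cK * ν * (t - s)) * ‖fc v ℓ‖ := by
      refine (norm_fc_le_norm _ _).trans (hUv.trans ?_)
      rw [hvn, Real.sqrt_mul (by norm_num : (0:ℝ) ≤ 2)]
      have hs0 : 0 ≤ Real.sqrt CK := Real.sqrt_nonneg _
      have := mul_le_mul_of_nonneg_left hx1 hs0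
      calc Real.sqrt CK * Real.exp (-(cK * ν * (t - s))) * (Real.sqrt 2 * ‖fc v ℓ‖)
          = (Real.sqrt CK * Real.exp (-(cK * ν * (t - s)))) * Real.sqrt 2 * ‖fc v ℓ‖ := by ring
        _ ≤ (Real.sqrt CK * (1 / (cK * ν * (t - s)))) * Real.sqrt 2 * ‖fc v ℓ‖ :=
            mul_le_mul_of_nonneg_right (mul_le_mul_of_nonneg_right this (Real.sqrt_nonneg _)) hv0
        _ = Real.sqrt 2 * Real.sqrt CK / (cK * ν * (t - s)) * ‖fc v ℓ‖ := by ring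
    have h2 : ‖fc (T s t v) ℓ‖ ≤ 2 / (R * (t - s)) * ‖fc v ℓ‖ := by
      refine hTv.trans (mul_le_mul_of_nonneg_right (hx2.trans (le_of_eq ?_)) hv0)
      field_simp
    calc ‖fc (U s t v) ℓ - fc (T s t v) ℓ‖ ≤ ‖fc (U s t v) ℓ‖ + ‖fc (T s t v) ℓ‖ := norm_sub_le _ _
      _ ≤ _ := by rw [add_mul]; exact add_le_add h1 h2
  -- ### … ≤ (C₁/4)·(P/τ)·‖𝓕v(ℓ)‖
  have hPτ0 : 0 < M * W.period / ν / (t - s) := div_pos hP0 hτ0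
  have hPτ1 : M * W.period / ν / (t - s) ≤ 1 := (div_le_one hτ0).2 hτP.le
  have hkey : Real.sqrt (2 * CK) / (cK * ν * (t - s)) + 2 / (R * (t - s)) ≤ (C₁ / 4) * (M * W.period / ν / (t - s)) := by
    -- `1/(ν τ) = (P/τ)/(M Wp)` and `1/(R τ) = (P/τ)/(R P) ≤ (P/τ)/θ′`
    have e1 : Real.sqrt (2 * CK) / (cK * ν * (t - s))
        = (4 * Real.sqrt (2 * CK) / (cK * (M * W.period))) / 4 * (M * W.period / ν / (t - s)) := by
      field_simp
    have hRP : θ' ≤ R * (M * W.period / ν) := by rw [hR]; exact hθ'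
    have hRτpos : 0 < R * (t - s) := mul_pos hRpos hτ0
    have h2 : 2 / (R * (t - s)) ≤ (8 / θ') / 4 * (M * W.period / ν / (t - s)) := by
      rw [div_le_iff₀ hRτpos]
      have e3 : (8 / θ') / 4 * (M * W.period / ν / (t - s)) * (R * (t - s)) = (2 / θ') * (R * (M * W.period / ν)) * ((t - s) / (t - s)) := by
        ring
      rw [e3, div_self hτ0.ne', mul_one]
      calc (2:ℝ) = (2 / θ') * θ' := by field_simp
        _ ≤ (2 / θ') * (R * (M * W.period / ν)) := mul_le_mul_of_nonneg_left hRP (by positivity)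
    rw [e1]
    refine (add_le_add le_rfl h2).trans ?_
    rw [← add_mul]
    refine mul_le_mul_of_nonneg_right ?_ hPτ0.le
    linarith
  -- ### the allowance: `dW ≥ ½`, `(min 1 (P/τ))^e = (P/τ)^e ≥ P/τ`
  have hRτ0 : 0 ≤ 8 * Real.pi ^ 2 * loT lo Λ c ν n * Torus.freqNormSq ℓ * (t - s) := le_trans zero_le_one hRτ
  have hdW : (1 / 2 : ℝ) ≤ dW lo Λ c ν n (t - s) ℓ := by
    have h := one_sub_exp_neg_ge hRτ0
    rw [min_eq_left hRτ] at h
    unfold dW; linarith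
  have hdW0 : 0 ≤ dW lo Λ c ν n (t - s) ℓ := le_trans (by norm_num) hdW
  have hmin : min 1 (M * W.period / ν / (t - s)) = M * W.period / ν / (t - s) := min_eq_right hPτ1
  have hrp : M * W.period / ν / (t - s) ≤ (M * W.period / ν / (t - s)) ^ e := by
    have h := Real.rpow_le_rpow_of_exponent_ge hPτ0 hPτ1 he1; rwa [Real.rpow_one] at h
  have halw : (C₁ / 2) * (M * W.period / ν / (t - s))
      ≤ C₁ * (C₁ * (ν ^ e + ((⌈K / ν⌉₊ : ℝ) / n) ^ e) + (min 1 ((M * W.period / ν) / (t - s))) ^ e) * dW lo Λ c ν n (t - s) ℓ := by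
    rw [hmin]
    have hb : 0 ≤ C₁ * (ν ^ e + ((⌈K / ν⌉₊ : ℝ) / n) ^ e) :=
      mul_nonneg hC₁0 (add_nonneg (Real.rpow_nonneg hν.1.le e) (Real.rpow_nonneg (by positivity) e))
    have h1 : C₁ * (M * W.period / ν / (t - s)) ≤ C₁ * (C₁ * (ν ^ e + ((⌈K / ν⌉₊ : ℝ) / n) ^ e) + (M * W.period / ν / (t - s)) ^ e) :=
      mul_le_mul_of_nonneg_left (by linarith) hC₁0
    have h0 : 0 ≤ C₁ * (M * W.period / ν / (t - s)) := mul_nonneg hC₁0 hPτ0.le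
    calc (C₁ / 2) * (M * W.period / ν / (t - s)) = C₁ * (M * W.period / ν / (t - s)) * (1 / 2) := by ring
      _ ≤ C₁ * (C₁ * (ν ^ e + ((⌈K / ν⌉₊ : ℝ) / n) ^ e) + (M * W.period / ν / (t - s)) ^ e) * dW lo Λ c ν n (t - s) ℓ :=
          mul_le_mul h1 hdW (by norm_num) (h0.trans h1)
  calc ‖fc (U s t v - T s t v) ℓ‖ ≤ (Real.sqrt (2 * CK) / (cK * ν * (t - s)) + 2 / (R * (t - s))) * ‖fc v ℓ‖ := hdef
    _ ≤ (C₁ / 4) * (M * W.period / ν / (t - s)) * ‖fc v ℓ‖ := mul_le_mul_of_nonneg_right hkey hv0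
    _ ≤ (C₁ / 2) * (M * W.period / ν / (t - s)) * ‖fc v ℓ‖ := by
        refine mul_le_mul_of_nonneg_right ?_ hv0; nlinarith [hPτ0.le]
    _ ≤ _ := mul_le_mul_of_nonneg_right halw hv0

end Clause

end Summit.AnomalousDissipation.AnomalousDissipation.Theorems.SolenoidalFractalHomogenisation.LagrangianStep.VmodGen

end
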